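import Literature.Analysis.Calculus.LevelSetStraightening
import Literature.Geometry.Lorentzian.ChartLaplacian
import Literature.Analysis.PDE.NeumannHalfBallRegularity
import HarnessLib

/-!
# Boundary-flattening charts for a regular sublevel domain `{σ < 0}` of a manifold

Topic `Geometry/Riemannian`. Theorem file (no definitions, no named facts; everything proved).
Let `M` be a `C^∞` manifold modelled on `ℝᵐ`, `σ : M → ℝ` smooth and `x₀` a regular point of the
zero level (`σ x₀ = 0`, `dσ(x₀) ≠ 0`). With `φ = extChartAt (𝓡 m) x₀`, `z = φ x₀`, the chart
representative `s = σ ∘ φ⁻¹` is straightened by the Euclidean construction of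
`Analysis/Calculus/LevelSetStraightening.lean`: there is a `C^∞` local diffeomorphism `Ψ` of `ℝᵐ`
with `Ψ.source ⊆ φ.target`, `Ψ z = z`, and `σ(φ⁻¹ y) = ⟪Ψ y - z, ν⟫` (`ν ≠ 0`), so that in the
composite coordinates `w = Ψ(φ p)` the domain `{σ < 0}` is the half-space `{⟪w - z, ν⟫ < 0}` and
`{σ = 0}` is the hyperplane through `z` (J. M. Lee, *Introduction to Smooth Manifolds* (2013),
Thm. 5.12 / Prop. 5.47; L. C. Evans, *PDE*, §C.1). We prove

* `exists_boundaryFlatteningChart` — existence of `Ψ, ν, R` with a closed ball `B̄(z, R) ⊆ Ψ.target`;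
* `sigma_compositeChart_symm` — `σ(φ⁻¹(Ψ⁻¹ w)) = ⟪w - z, ν⟫` on `Ψ.target`;
* `sublevel_inter_compositePiece`, `zeroLevel_inter_compositePiece` — the pieces
  `φ.source ∩ φ⁻¹(Ψ⁻¹ B)` meet `{σ < 0}` / `{σ ≤ 0}` exactly in the pieces over
  `B ∩ {⟪w - z, ν⟫ < 0}` / `B ∩ {⟪w - z, ν⟫ ≤ 0}`;
* `isOpen_compositePiece`, `mem_compositePiece`, `compositePiece_subset_of_ball_subset` — the
  pieces over open sets are open, the piece over a ball about `z` contains `x₀`, and every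
  neighbourhood of `x₀` contains such a piece;
* `isPreconnected_sublevel_inter_compositePiece_ball` — **local connectedness of `{σ < 0}` at
  regular boundary points**: `{σ < 0} ∩ (piece over B(z, r))` is (pre)connected, being the image of
  the convex half-ball under the continuous map `φ⁻¹ ∘ Ψ⁻¹`.

Used by the connected-domain selection, the Poincaré inequality and the boundary regularity of
the Neumann problem on `{σ < 0}` (discharge path of
`Literature.Geometry.Riemannian.sharpLogSobolevAVR_four`).

## References

* J. M. Lee, *Introduction to Smooth Manifolds*, 2nd ed. (2013), Thm. 5.12, Prop. 5.47.
  [LeeSmoothManifolds2013]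
* L. C. Evans, *Partial Differential Equations*, 2nd ed. (2010), §C.1. [Evans2010]
-/

noncomputable section

open Set Function Filter TopologicalSpace Manifold Metric InnerProductSpace
open scoped Manifold ContDiff Topology RealInnerProductSpace

namespace Literature.Geometry.Riemannian

open Lorentzian Literature.Analysis.Calculus Literature.Analysis.PDE

variable {m : ℕ} {M : Type*} [TopologicalSpace M] [ChartedSpace (EuclideanSpace ℝ (Fin m)) M]
  [IsManifold (𝓡 m) ∞ M]

/-! ### Existence -/

/-- **Boundary-flattening chart at a regular point of the zero level** (Lee 2013, Thm. 5.12;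
Evans, §C.1): for `σ ∈ C^∞(M)` and `x₀` with `σ x₀ = 0`, `dσ(x₀) ≠ 0`, and `φ = extChartAt (𝓡 m) x₀`,
`z = φ x₀`, there are a `C^∞` local diffeomorphism `Ψ` of `ℝᵐ` (with `C^∞` inverse), a vector
`ν ≠ 0` and a radius `R > 0` with `Ψ.source ⊆ φ.target`, `z ∈ Ψ.source`, `Ψ z = z`,
`B̄(z, R) ⊆ Ψ.target`, and `σ(φ⁻¹ y) = ⟪Ψ y - z, ν⟫` for all `y ∈ Ψ.source`.
[cite: LeeSmoothManifolds2013, Thm. 5.12] -/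
theorem exists_boundaryFlatteningChart {σ : M → ℝ} (hσ : ContMDiff (𝓡 m) 𝓘(ℝ, ℝ) ∞ σ) {x₀ : M}
    (hσ0 : σ x₀ = 0) (hreg : mfderiv (𝓡 m) 𝓘(ℝ, ℝ) σ x₀ ≠ 0) :
    ∃ (Ψ : OpenPartialHomeomorph (EuclideanSpace ℝ (Fin m)) (EuclideanSpace ℝ (Fin m)))
      (ν : EuclideanSpace ℝ (Fin m)) (R : ℝ), ν ≠ 0 ∧ 0 < R ∧
      Ψ.source ⊆ (extChartAt (𝓡 m) x₀).target ∧ extChartAt (𝓡 m) x₀ x₀ ∈ Ψ.source ∧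
      Ψ (extChartAt (𝓡 m) x₀ x₀) = extChartAt (𝓡 m) x₀ x₀ ∧
      ContDiffOn ℝ ∞ Ψ Ψ.source ∧ ContDiffOn ℝ ∞ Ψ.symm Ψ.target ∧
      closedBall (extChartAt (𝓡 m) x₀ x₀) R ⊆ Ψ.target ∧
      ∀ y ∈ Ψ.source, ⟪Ψ y - extChartAt (𝓡 m) x₀ x₀, ν⟫ = σ ((extChartAt (𝓡 m) x₀).symm y) := by
  set φ := extChartAt (𝓡 m) x₀ with hφ
  set z := φ x₀ with hz_def
  set s : EuclideanSpace ℝ (Fin m) → ℝ := σ ∘ φ.symm with hs_def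
  have hT : IsOpen φ.target := isOpen_extChartAt_target x₀
  have hzT : z ∈ φ.target := φ.map_source (mem_extChartAt_source x₀)
  have hs : ContDiffOn ℝ ∞ s φ.target := contDiffOn_comp_extChartAt_symm hσ
  have hs0 : s z = 0 := by
    simp only [hs_def, Function.comp_apply, hz_def, φ.left_inv (mem_extChartAt_source x₀), hσ0]
  -- the derivative of `s` at `z` is `mfderiv σ x₀`, read as a Fréchet derivative
  have hsd : DifferentiableAt ℝ s z := (hs.differentiableOn (by simp) z hzT).differentiableAt
    (hT.mem_nhds hzT)
  have hmf : mfderiv (𝓡 m) 𝓘(ℝ, ℝ) σ x₀ = fderiv ℝ s z := by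
    have hmd : MDifferentiableAt (𝓡 m) 𝓘(ℝ, ℝ) σ x₀ := hσ.mdifferentiableAt (by simp)
    rw [hmd.mfderiv]
    simp only [writtenInExtChartAt, extChartAt_model_space_eq_id, PartialEquiv.refl_coe,
      Function.id_comp, ModelWithCorners.Boundaryless.range_eq_univ, fderivWithin_univ]
    rfl
  have hℓ : fderiv ℝ s z ≠ 0 := by rwa [← hmf]
  -- the gradient vector
  set ν : EuclideanSpace ℝ (Fin m) := (InnerProductSpace.toDual ℝ _).symm (fderiv ℝ s z) with hν_def
  have hνℓ : innerSL ℝ ν = fderiv ℝ s z := by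
    ext y
    rw [innerSL_apply_apply, hν_def, ← InnerProductSpace.toDual_apply_apply,
      LinearIsometryEquiv.apply_symm_apply]
  have hν : ν ≠ 0 := by
    intro h0
    apply hℓ
    rw [← hνℓ, h0, map_zero]
  have hds : HasFDerivAt s (innerSL ℝ ν) z := by rw [hνℓ]; exact hsd.hasFDerivAt
  obtain ⟨Ψ, hzΨ, hΨV, hΨz, hΨc, hΨc', hlin, -⟩ := exists_straightening hT hs hzT hs0 hν hds
  -- a closed ball in the (open) target about `z = Ψ z`
  have hzt : z ∈ Ψ.target := by rw [← hΨz]; exact Ψ.map_source hzΨ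
  obtain ⟨R, hR, hball⟩ := Metric.nhds_basis_closedBall.mem_iff.1 (Ψ.open_target.mem_nhds hzt)
  exact ⟨Ψ, ν, R, hν, hR, hΨV, hzΨ, hΨz, hΨc, hΨc', hball, hlin⟩

/-! ### The domain in composite coordinates -/

section Pieces

variable {σ : M → ℝ} {x₀ : M}
  {Ψ : OpenPartialHomeomorph (EuclideanSpace ℝ (Fin m)) (EuclideanSpace ℝ (Fin m))}
  {ν : EuclideanSpace ℝ (Fin m)}

omit [IsManifold (𝓡 m) ∞ M] in
/-- **`σ` is linear in composite coordinates**: `σ(φ⁻¹(Ψ⁻¹ w)) = ⟪w - z, ν⟫` for `w ∈ Ψ.target`.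
[folklore] -/
theorem sigma_compositeChart_symm
    (hlin : ∀ y ∈ Ψ.source, ⟪Ψ y - extChartAt (𝓡 m) x₀ x₀, ν⟫ = σ ((extChartAt (𝓡 m) x₀).symm y))
    {w : EuclideanSpace ℝ (Fin m)} (hw : w ∈ Ψ.target) :
    σ ((extChartAt (𝓡 m) x₀).symm (Ψ.symm w)) = ⟪w - extChartAt (𝓡 m) x₀ x₀, ν⟫ := by
  have h := hlin (Ψ.symm w) (Ψ.map_target hw)
  rw [Ψ.right_inv hw] at h
  exact h.symm

omit [IsManifold (𝓡 m) ∞ M] in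
/-- **The sublevel set in a composite piece**: for `B ⊆ Ψ.target`,
`{σ < 0} ∩ (φ.source ∩ φ⁻¹(Ψ⁻¹ B)) = φ.source ∩ φ⁻¹(Ψ⁻¹ (B ∩ {⟪w - z, ν⟫ < 0}))` — the piece over
the half of `B`. [folklore] -/
theorem sublevel_inter_compositePiece
    (hlin : ∀ y ∈ Ψ.source, ⟪Ψ y - extChartAt (𝓡 m) x₀ x₀, ν⟫ = σ ((extChartAt (𝓡 m) x₀).symm y))
    {B : Set (EuclideanSpace ℝ (Fin m))} (hB : B ⊆ Ψ.target) :
    {p | σ p < 0} ∩ ((extChartAt (𝓡 m) x₀).source ∩ extChartAt (𝓡 m) x₀ ⁻¹' (Ψ.symm '' B)) =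
      (extChartAt (𝓡 m) x₀).source ∩ extChartAt (𝓡 m) x₀ ⁻¹'
        (Ψ.symm '' (B ∩ {w | ⟪w - extChartAt (𝓡 m) x₀ x₀, ν⟫ < 0})) := by
  set φ := extChartAt (𝓡 m) x₀ with hφ
  ext p
  simp only [mem_inter_iff, mem_setOf_eq, mem_preimage, mem_image]
  constructor
  · rintro ⟨hσp, hp, w, hwB, hw⟩
    refine ⟨hp, w, ⟨hwB, ?_⟩, hw⟩
    have h1 := sigma_compositeChart_symm hlin (hB hwB)
    rw [hw, φ.left_inv hp] at h1
    rwa [← h1]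
  · rintro ⟨hp, w, ⟨hwB, hwν⟩, hw⟩
    refine ⟨?_, hp, w, hwB, hw⟩
    have h1 := sigma_compositeChart_symm hlin (hB hwB)
    rw [hw, φ.left_inv hp] at h1
    rwa [h1]

omit [IsManifold (𝓡 m) ∞ M] in
/-- **The closed sublevel set in a composite piece**: for `B ⊆ Ψ.target`,
`{σ ≤ 0} ∩ (φ.source ∩ φ⁻¹(Ψ⁻¹ B)) = φ.source ∩ φ⁻¹(Ψ⁻¹ (B ∩ {⟪w - z, ν⟫ ≤ 0}))`. [folklore] -/
theorem sublevelClosed_inter_compositePiece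
    (hlin : ∀ y ∈ Ψ.source, ⟪Ψ y - extChartAt (𝓡 m) x₀ x₀, ν⟫ = σ ((extChartAt (𝓡 m) x₀).symm y))
    {B : Set (EuclideanSpace ℝ (Fin m))} (hB : B ⊆ Ψ.target) :
    {p | σ p ≤ 0} ∩ ((extChartAt (𝓡 m) x₀).source ∩ extChartAt (𝓡 m) x₀ ⁻¹' (Ψ.symm '' B)) =
      (extChartAt (𝓡 m) x₀).source ∩ extChartAt (𝓡 m) x₀ ⁻¹'
        (Ψ.symm '' (B ∩ {w | ⟪w - extChartAt (𝓡 m) x₀ x₀, ν⟫ ≤ 0})) := by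
  set φ := extChartAt (𝓡 m) x₀ with hφ
  ext p
  simp only [mem_inter_iff, mem_setOf_eq, mem_preimage, mem_image]
  constructor
  · rintro ⟨hσp, hp, w, hwB, hw⟩
    refine ⟨hp, w, ⟨hwB, ?_⟩, hw⟩
    have h1 := sigma_compositeChart_symm hlin (hB hwB)
    rw [hw, φ.left_inv hp] at h1
    rwa [← h1]
  · rintro ⟨hp, w, ⟨hwB, hwν⟩, hw⟩
    refine ⟨?_, hp, w, hwB, hw⟩
    have h1 := sigma_compositeChart_symm hlin (hB hwB)
    rw [hw, φ.left_inv hp] at h1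
    rwa [h1]

omit [IsManifold (𝓡 m) ∞ M] in
/-- **The zero level in a composite piece**: for `B ⊆ Ψ.target`, a point `p` of the piece over `B`
has `σ p = 0` iff its coordinate `w` (`Ψ⁻¹ w = φ p`) lies on the hyperplane `⟪w - z, ν⟫ = 0`.
[folklore] -/
theorem sigma_eq_zero_iff_of_mem_compositePiece
    (hlin : ∀ y ∈ Ψ.source, ⟪Ψ y - extChartAt (𝓡 m) x₀ x₀, ν⟫ = σ ((extChartAt (𝓡 m) x₀).symm y))
    {p : M} (hp : p ∈ (extChartAt (𝓡 m) x₀).source) {w : EuclideanSpace ℝ (Fin m)}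
    (hw : w ∈ Ψ.target) (hpw : Ψ.symm w = extChartAt (𝓡 m) x₀ p) :
    σ p = ⟪w - extChartAt (𝓡 m) x₀ x₀, ν⟫ := by
  have h1 := sigma_compositeChart_symm hlin hw
  rwa [hpw, (extChartAt (𝓡 m) x₀).left_inv hp] at h1

omit [IsManifold (𝓡 m) ∞ M] in
/-- **Composite pieces over open sets are open.** [folklore] -/
theorem isOpen_compositePiece {B : Set (EuclideanSpace ℝ (Fin m))} (hBo : IsOpen B)
    (hB : B ⊆ Ψ.target) :
    IsOpen ((extChartAt (𝓡 m) x₀).source ∩ extChartAt (𝓡 m) x₀ ⁻¹' (Ψ.symm '' B)) := by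
  have h1 : IsOpen (Ψ.symm '' B) := by
    rw [Ψ.symm_image_eq_source_inter_preimage hB]
    exact Ψ.continuousOn.isOpen_inter_preimage Ψ.open_source hBo
  exact isOpen_extChartAt_preimage' x₀ h1

omit [IsManifold (𝓡 m) ∞ M] in
/-- The base point lies in the composite piece over any set containing `z = Ψ z`. [folklore] -/
theorem mem_compositePiece (hzΨ : extChartAt (𝓡 m) x₀ x₀ ∈ Ψ.source)
    (hΨz : Ψ (extChartAt (𝓡 m) x₀ x₀) = extChartAt (𝓡 m) x₀ x₀)
    {B : Set (EuclideanSpace ℝ (Fin m))} (hzB : extChartAt (𝓡 m) x₀ x₀ ∈ B) :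
    x₀ ∈ (extChartAt (𝓡 m) x₀).source ∩ extChartAt (𝓡 m) x₀ ⁻¹' (Ψ.symm '' B) := by
  refine ⟨mem_extChartAt_source x₀, extChartAt (𝓡 m) x₀ x₀, hzB, ?_⟩
  have h1 := Ψ.left_inv hzΨ
  rwa [hΨz] at h1

omit [IsManifold (𝓡 m) ∞ M] in
/-- **Every neighbourhood of `x₀` contains a composite piece over a ball about `z`** (continuity of
`Ψ ∘ φ` at `x₀`). [folklore] -/
theorem exists_compositePiece_ball_subset (hzΨ : extChartAt (𝓡 m) x₀ x₀ ∈ Ψ.source)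
    (hΨz : Ψ (extChartAt (𝓡 m) x₀ x₀) = extChartAt (𝓡 m) x₀ x₀) {U : Set M} (hU : U ∈ 𝓝 x₀) :
    ∃ r > 0, closedBall (extChartAt (𝓡 m) x₀ x₀) r ⊆ Ψ.target ∧
      (extChartAt (𝓡 m) x₀).source ∩ extChartAt (𝓡 m) x₀ ⁻¹'
        (Ψ.symm '' ball (extChartAt (𝓡 m) x₀ x₀) r) ⊆ U := by
  set φ := extChartAt (𝓡 m) x₀ with hφ
  have hsymm : Ψ.symm (φ x₀) = φ x₀ := by
    have h1 := Ψ.left_inv hzΨ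
    rwa [hΨz] at h1
  have hzt : φ x₀ ∈ Ψ.target := by rw [← hΨz]; exact Ψ.map_source hzΨ
  -- continuity of `φ⁻¹ ∘ Ψ⁻¹` at `z = φ x₀`, which maps `z` to `x₀`
  have hx₀ : φ.symm (Ψ.symm (φ x₀)) = x₀ := by
    rw [hsymm]; exact φ.left_inv (mem_extChartAt_source x₀)
  have hc1 : ContinuousAt Ψ.symm (φ x₀) := Ψ.continuousAt_symm hzt
  have hyT : Ψ.symm (φ x₀) ∈ φ.target := by
    rw [hsymm]; exact φ.map_source (mem_extChartAt_source x₀)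
  have hc2 : ContinuousAt φ.symm (Ψ.symm (φ x₀)) := continuousAt_extChartAt_symm'' hyT
  have hc : ContinuousAt (fun w => φ.symm (Ψ.symm w)) (φ x₀) := ContinuousAt.comp hc2 hc1
  have hU' : (fun w => φ.symm (Ψ.symm w)) ⁻¹' U ∈ 𝓝 (φ x₀) := by
    refine hc.preimage_mem_nhds ?_
    show U ∈ 𝓝 (φ.symm (Ψ.symm (φ x₀)))
    rw [hx₀]; exact hU
  obtain ⟨r₁, hr₁, hball₁⟩ := Metric.nhds_basis_closedBall.mem_iff.1 hU'
  obtain ⟨r₂, hr₂, hball₂⟩ := Metric.nhds_basis_closedBall.mem_iff.1 (Ψ.open_target.mem_nhds hzt)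
  refine ⟨min r₁ r₂, lt_min hr₁ hr₂,
    (closedBall_subset_closedBall (min_le_right _ _)).trans hball₂, ?_⟩
  rintro p ⟨hp, w, hw, hwp⟩
  have hwU : w ∈ (fun w => φ.symm (Ψ.symm w)) ⁻¹' U :=
    hball₁ (closedBall_subset_closedBall (min_le_left _ _) (ball_subset_closedBall hw))
  simp only [mem_preimage, hwp, φ.left_inv hp] at hwU
  exact hwU

omit [IsManifold (𝓡 m) ∞ M] in
/-- **Local connectedness of `{σ < 0}` at a regular boundary point**: the part of `{σ < 0}` in the
composite piece over a ball `B(z, r) ⊆ Ψ.target` is preconnected — it is the image of the convex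
half-ball `B(z, r) ∩ {⟪w - z, ν⟫ < 0}` under the continuous map `φ⁻¹ ∘ Ψ⁻¹`. [folklore] -/
theorem isPreconnected_sublevel_inter_compositePiece_ball
    (hΨV : Ψ.source ⊆ (extChartAt (𝓡 m) x₀).target)
    (hlin : ∀ y ∈ Ψ.source, ⟪Ψ y - extChartAt (𝓡 m) x₀ x₀, ν⟫ = σ ((extChartAt (𝓡 m) x₀).symm y))
    {r : ℝ} (hr : ball (extChartAt (𝓡 m) x₀ x₀) r ⊆ Ψ.target) :
    IsPreconnected ({p | σ p < 0} ∩ ((extChartAt (𝓡 m) x₀).source ∩ extChartAt (𝓡 m) x₀ ⁻¹'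
      (Ψ.symm '' ball (extChartAt (𝓡 m) x₀ x₀) r))) := by
  set φ := extChartAt (𝓡 m) x₀ with hφ
  set z := φ x₀ with hz
  rw [sublevel_inter_compositePiece hlin hr]
  -- the piece over the half-ball is the image of the half-ball under `φ⁻¹ ∘ Ψ⁻¹`
  set Q : Set (EuclideanSpace ℝ (Fin m)) := ball z r ∩ {w | ⟪w - z, ν⟫ < 0} with hQ
  have hQt : Q ⊆ Ψ.target := inter_subset_left.trans hr
  have himg : φ.source ∩ φ ⁻¹' (Ψ.symm '' Q) = (fun w => φ.symm (Ψ.symm w)) '' Q := by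
    ext p
    simp only [mem_inter_iff, mem_preimage, mem_image]
    constructor
    · rintro ⟨hp, w, hwQ, hw⟩
      exact ⟨w, hwQ, by rw [hw, φ.left_inv hp]⟩
    · rintro ⟨w, hwQ, rfl⟩
      have hy : Ψ.symm w ∈ φ.target := hΨV (Ψ.map_target (hQt hwQ))
      exact ⟨φ.map_target hy, w, hwQ, (φ.right_inv hy).symm⟩
  rw [himg]
  have hQc : Convex ℝ Q := by
    have e : Q = (halfBall ν z r : Set (EuclideanSpace ℝ (Fin m))) := by
      rw [hQ, halfBall_coe]; rfl
    rw [e]; exact convex_halfBall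
  refine hQc.isPreconnected.image _ ?_
  refine ContinuousOn.comp (continuousOn_extChartAt_symm x₀) (Ψ.continuousOn_symm.mono hQt) ?_
  exact fun w hw => hΨV (Ψ.map_target (hQt hw))

end Pieces

end Literature.Geometry.Riemannian

end
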